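import Summits.ResolutionOfSingularities.ResolutionOfSingularities.Theorems.FrobeniusClosingPatchingRelPerfectDepthMultiHostInitial
import Summits.ResolutionOfSingularities.ResolutionOfSingularities.Theorems.FrobeniusClosingPatchingRelPerfectDepthMultiHostInitialParam
import Summits.ResolutionOfSingularities.ResolutionOfSingularities.Theorems.FrobeniusClosingPatchingRelPerfectDepthMultiHostInitialOffE
import Summits.ResolutionOfSingularities.ResolutionOfSingularities.Theorems.FrobeniusClosingPatchingRelPerfectDepthDirectionMapRegular
import HarnessLib

/-!
# `PatchingRelPerfect` (stmt-ResolutionOfSingularities-16161), chain W5.2 — F7(β) (β-AX) **T0 `InitialMultiHost₂` HOLDS**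

[OURS · L1 W5.2 · res-D-pv-055 (hand for T0; plan-1 RULINGS G11-13/18/27/31, spec v4.2 §7 A2/A3, targets v5+)] The closer of T0: the
packaging `initialMultiHost₂_of_param` (p552524) fed with the parameter-lift property of `⊤.ι ≫ R₀` at EVERY point of `X₁`, assembled
from the E-points (`isParamLiftAt_top_retraction₀_of_offE`, p553935), the off-E plumbing (`isParamLiftAt_retraction₀_of_not_mem_support`,
`…DepthMultiHostInitialOffE`) and res-D-pv-046's DIRECTION-MAP THEOREM (`directionMap_flat_and_isRegularLocalRing_fiber`,
`…DepthDirectionMapRegular`, p553231/p553979: for `S` complete regular local with coefficient field, the map `κ₀[u] → S_𝔭`,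
`u_i ↦ x_{j.succAbove i}/x_j`, is flat with regular closed fibre), moved to an arbitrary localisation model by `IsLocalization.algEquiv`
(`directionMap_flat_and_isRegularLocalRing_fiber_model`).

* `initialMultiHost₂` — for `S` complete regular local of dimension four with a coefficient field `σ`, `x` generators of `𝔪`, non-zero
  quadratic forms `P_j`: the initial cylinder state of the member `(P_j(x))_j + (x_k^4)_k` EXISTS (targets-v5 conclusion of
  `InitialMultiHost₂`, fact-free).

Honest framing: OURS (AI-written, weaker than expert review); nothing here is a statement of the manuscript under review.

## Sources
* H. Matsumura, *Commutative Ring Theory* (1987), Thm. 23.1, 23.7, 28.3, §32. [Matsumura1987]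
* J. Kollár, *Lectures on Resolution of Singularities* (2007), (3.111) Steps 1–3. [Kollar2007]
* E. Bierstone, D. Grigoriev, P. Milman, J. Włodarczyk (2011), Def. 3.1.3. [BierstoneGrigorievMilmanWlodarczyk2011]
-/

set_option linter.dupNamespace false -- mandated namespace of this single-conjunct summit

noncomputable section

open CategoryTheory CategoryTheory.Limits AlgebraicGeometry Literature.AlgebraicGeometry.Resolution
open IsLocalRing TopologicalSpace HomogeneousLocalization Scheme.IdealSheafData
open Literature.AlgebraicGeometry.Motives Literature.AlgebraicGeometry.Motives.ProjBaseChangeRing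

namespace Summit.ResolutionOfSingularities.ResolutionOfSingularities.Theorems.DepthMultiHost

universe u

/-- **The direction-map theorem in localisation-model form**: res-D-pv-046's `directionMap_flat_and_isRegularLocalRing_fiber` moved from
`Localization.AtPrime 𝔭` to any `S`-algebra `B` which is a localisation of `S` at `𝔭` (along `IsLocalization.algEquiv`; flatness by
composition with the isomorphism, the fibre by `Ideal.quotientEquiv`). [cite: Matsumura1987, Thm. 23.7] -/
theorem directionMap_flat_and_isRegularLocalRing_fiber_model {κ₀ S : Type u} [Field κ₀] [CommRing S] [IsRegularLocalRing S]
    [IsAdicComplete (maximalIdeal S) S] (σ : κ₀ →+* S) (hσ : Function.Bijective ⇑((residue S).comp σ)) {n : ℕ}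
    (x : Fin (n + 1) → S) (hx : Ideal.span (Set.range x) = maximalIdeal S) (hd : ringKrullDim S = (n + 1 : ℕ))
    (𝔭 : Ideal S) [𝔭.IsPrime] (j : Fin (n + 1)) (hj : x j ∉ 𝔭)
    (B : Type u) [CommRing B] [Algebra S B] [IsLocalRing B] [IsLocalization.AtPrime B 𝔭]
    (ψ : MvPolynomial (Fin n) κ₀ →+* B) (hψC : ∀ c, ψ (MvPolynomial.C c) = algebraMap S B (σ c))
    (hψX : ∀ i, ψ (MvPolynomial.X i) * algebraMap S B (x j) = algebraMap S B (x (j.succAbove i))) :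
    ψ.Flat ∧ IsRegularLocalRing (B ⧸ Ideal.map ψ ((maximalIdeal B).comap ψ)) := by
  set e : Localization.AtPrime 𝔭 ≃ₐ[S] B := IsLocalization.algEquiv 𝔭.primeCompl (Localization.AtPrime 𝔭) B with he
  set ψ₀ : MvPolynomial (Fin n) κ₀ →+* Localization.AtPrime 𝔭 := e.symm.toRingEquiv.toRingHom.comp ψ with hψ₀
  have hψ₀C : ∀ c, ψ₀ (MvPolynomial.C c) = algebraMap S (Localization.AtPrime 𝔭) (σ c) := by
    intro c
    simp only [hψ₀, RingHom.comp_apply, hψC, RingEquiv.toRingHom_eq_coe, RingEquiv.coe_toRingHom, AlgEquiv.coe_ringEquiv,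
      AlgEquiv.commutes]
  have hψ₀X : ∀ i, ψ₀ (MvPolynomial.X i) * algebraMap S (Localization.AtPrime 𝔭) (x j) =
      algebraMap S (Localization.AtPrime 𝔭) (x (j.succAbove i)) := by
    intro i
    have h := congrArg e.symm (hψX i)
    rw [map_mul, AlgEquiv.commutes, AlgEquiv.commutes] at h
    simpa only [hψ₀, RingHom.comp_apply, RingEquiv.toRingHom_eq_coe, RingEquiv.coe_toRingHom, AlgEquiv.coe_ringEquiv] using h
  obtain ⟨hflat₀, hfib₀⟩ := directionMap_flat_and_isRegularLocalRing_fiber σ hσ x hx hd 𝔭 j hj ψ₀ hψ₀C hψ₀X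
  have hψ : ψ = e.toRingEquiv.toRingHom.comp ψ₀ := by
    ext q <;> simp [hψ₀]
  constructor
  · rw [hψ]
    exact RingHom.Flat.comp hflat₀ (RingHom.Flat.of_bijective e.bijective)
  · -- the fibre ideals correspond under `e`
    have hmax : (maximalIdeal B).comap e.toRingEquiv.toRingHom = maximalIdeal (Localization.AtPrime 𝔭) := by
      rw [← IsLocalRing.map_ringEquiv_maximalIdeal e.toRingEquiv]
      exact Ideal.comap_map_of_bijective _ e.toRingEquiv.bijective
    have hid : Ideal.map ψ ((maximalIdeal B).comap ψ) =
        Ideal.map e.toRingEquiv.toRingHom (Ideal.map ψ₀ ((maximalIdeal (Localization.AtPrime 𝔭)).comap ψ₀)) := by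
      rw [hψ, Ideal.map_map, ← Ideal.comap_comap, hmax]
    rw [hid]
    exact IsRegularLocalRing.of_ringEquiv (Ideal.quotientEquiv _ _ e.toRingEquiv rfl)

/-- **F7(β) (β-AX) T0 — `InitialMultiHost₂` HOLDS (fact-free).** For `S` complete regular local of dimension four with a coefficient
field `σ`, `x` generators of `𝔪` and non-zero quadratic forms `P_j ∈ κ₀[T₀,…,T₃]₂`: there are `X = Bl_𝔪 Spec S`, `g = π`, `i : ℙ³ ⟶ X`,
`K`, a multi-host state `St` (`St.K = K`, `St.n = s + 1`, `St.𝓔 = [ker i]`) and a cylinder state `cyl` over it with carrier `ℙ³`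
(`cyl.j = i`, `cyl.V = ⊤`) such that the depth-two invariant holds for the member `(P_j(x))_j + (x_k^4)_k`, `X` is excellent and the carrier
is integral, Noetherian, regular, excellent, three-dimensional. (= `initialMultiHost₂_of_param` + the parameter-lift property of
`⊤.ι ≫ R₀` at every point: E-points by retraction, off E by the direction-map theorem.)
[cite: Matsumura1987, Thm. 23.7] [cite: Kollar2007, (3.111) Steps 1–3] [cite: BierstoneGrigorievMilmanWlodarczyk2011, Def. 3.1.3] -/
theorem initialMultiHost₂
    (S : Type u) [CommRing S] [IsRegularLocalRing S] [IsAdicComplete (IsLocalRing.maximalIdeal S) S]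
    (hdim : ringKrullDim S = (4 : ℕ))
    (κ₀ : Type u) [Field κ₀] (σ : κ₀ →+* S) (hσ : Function.Bijective ⇑((IsLocalRing.residue S).comp σ))
    (x : Fin 4 → S) (hx : Ideal.span (Set.range x) = IsLocalRing.maximalIdeal S)
    (s : ℕ) (P : Fin s → MvPolynomial (Fin 4) κ₀)
    (hP : ∀ j, P j ∈ MvPolynomial.homogeneousSubmodule (Fin 4) κ₀ 2) (hP0 : ∀ j, P j ≠ 0) :
    ∃ (X : Scheme.{u}) (g : X ⟶ Spec (.of S)) (i : ProjSpace.P 3 κ₀ ⟶ X) (K : X.IdealSheafData)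
      (_ : IsNoetherian X) (St : MultiHostState X) (cyl : CylState St) (_ : IsIntegral cyl.Z) (_ : IsNoetherian cyl.Z),
      DepthTargets.DepthInvariant 2 S (DepthTargets.gradedMemberIdeal σ x 2 2 P) (ProjSpace.P 3 κ₀) X i g K ∧
      Scheme.IsExcellent X ∧ St.K = K ∧ St.n ≠ 0 ∧ (∀ T ∈ St.𝓔, T = cyl.j.ker) ∧ Set.range cyl.j.base ⊆ Set.range i.base ∧
      cyl.V = ⊤ ∧ Scheme.IsRegular cyl.Z ∧ Scheme.IsExcellent cyl.Z ∧ topologicalKrullDim cyl.Z = 3 := by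
  letI : Algebra κ₀ S := σ.toAlgebra
  have hd : (IsLocalRing.maximalIdeal S).spanFinrank = 3 + 1 := by
    have h := IsRegularLocalRing.spanFinrank_maximalIdeal (R := S)
    rw [hdim] at h
    exact_mod_cast h
  have hd' : ringKrullDim S = ((3 + 1 : ℕ) : WithBot ℕ∞) := hdim
  have hqr : IsQuasiRegular x := isQuasiRegular_regularSystemOfParameters hd x hx
  have hκ := DepthOne.bijective_algebraMap_quotient_of_coefficientField x hx σ hσ
  refine initialMultiHost₂_of_param S hdim κ₀ σ hσ x hx s P hP hP0 ?_
  refine isParamLiftAt_top_retraction₀_of_offE x κ₀ hqr hκ hx fun y₀ hy₀ => ?_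
  refine isParamLiftAt_retraction₀_of_not_mem_support x κ₀ ?_ y₀ hy₀
  intro 𝔭 _ j hj B _ _ _ _ ψ hψC hψX
  exact directionMap_flat_and_isRegularLocalRing_fiber_model σ hσ x hx hd' 𝔭 j hj B ψ hψC hψX

end Summit.ResolutionOfSingularities.ResolutionOfSingularities.Theorems.DepthMultiHost

end
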